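import Literature.Computability.Complexity.OrOfRestrictions
import HarnessLib

/-!
# The DNF over hard-wired copies of a circuit (the consistency circuit of the easy-witness simulations)

Literature / circuit complexity toolkit. The algorithms-to-lower-bounds simulations of Williams
(J. ACM 2014, proof of Thm. 3.2 / Thm. 1.1: "for all `j`, the circuit `D` … checks that the
outputs claimed by `C'` for the gate `j` and its two inputs are consistent") and of
Murray–Williams (STOC 2018, §5, proof of Thm. 1.1/1.2: "consider the circuit
`D = ¬⋀ᵢ Fᵢ(E(C, W, x, i), E(C, W, x, i₁), E(C, W, x, i₂))` … since `C` is closed under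
conjunctions and projections, given `E` … the circuit `D` can be computed, where `D` is a
circuit from `C`") feed to the `C`-SAT algorithm a circuit built SYNTACTICALLY from a guessed
`C`-circuit `E`: a constant number of copies of `E` with some inputs hard-wired (the index of a
gate / of a tableau cell), combined by a constant-size Boolean condition, OR-ed over all
indices. With the local condition in disjunctive normal form this is one explicit shape — an
`∨` of `∧`s of possibly negated hard-wired copies of `E` — which this file constructs on the
tree's straight-line circuits, with its semantics and its bookkeeping (basis, size, depth,
fan-in), in the explicit style of `OrOfRestrictions.lean` (so that a machine emitting the
circuit gate by gate can later be specified against it):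

* `GateList.bigBlock isAnd bs` — the `∧`/`∨` of a list of blocks (gate list with output wire):
  the blocks side by side (`GateList.parBlocks`) and one unbounded fan-in gate; well-formedness,
  basis, length, value (`GateList.wireOf_bigBlock`), depth `≤ max + 1`, arities;
* `GateList.litBlock E σ pol` — the copy of `E` re-addressed along `σ : ι' → ι ⊕ Bool`
  (`GateList.hwGates`/`hwOut`, `OrOfRestrictions.lean`), followed by a `¬` gate if `pol = false`;
  value `[E(x ∘ σ) = pol]`, depth `≤ E.acDepth + 1` (negations are free), `E.size + 2` or
  `E.size + 3` gates;
* **`Circuit.dnfOfCopies E pats`** — for a list `pats` of patterns, each a list of literals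
  `(σ, pol)`: the circuit `⋁_{p ∈ pats} ⋀_{(σ, pol) ∈ p} [E(x ∘ σ) = pol]` on the inputs `ι`;
  **`Circuit.eval_dnfOfCopies`** (semantics), **`Circuit.dnfOfCopies_isOver`** (over any basis
  `B ⊇ acBasis` containing the gates of `E`; `AC⁰[m]` stays `AC⁰[m]`,
  `Circuit.dnfOfCopies_isOver_accBasis`), **`Circuit.size_dnfOfCopies_le`**,
  **`Circuit.acDepth_dnfOfCopies_le`** (`≤ E.acDepth + 3`), **`Circuit.maxFanIn_dnfOfCopies_le`**;
* **`Circuit.dnfOfLits pats`** — the same with a circuit PER LITERAL (`(C, σ, pol)`: copies of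
  different circuits on the same input type may be mixed, e.g. the claimed-value circuit `E`,
  the witness circuit `W`, and the projection circuits realising plain input literals `xᵢ`,
  `¬xᵢ`), with `Circuit.eval_dnfOfLits`(`_eq_true_iff`), `Circuit.not_satisfiable_dnfOfLits_iff`,
  `Circuit.dnfOfLits_isOver`, `Circuit.size_dnfOfLits_le`, `Circuit.acDepth_dnfOfLits_le`,
  `Circuit.maxFanIn_dnfOfLits_le` under uniform bounds on the literal circuits.

No named fact is introduced (definitions with their proved properties only).

## References

* R. Williams, *Nonuniform ACC circuit lower bounds*, J. ACM 61 (2014), proofs of Thm. 3.2 and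
  Thm. 1.1 (the circuit `D` over the `EVAL` circuit) [Williams2014].
* C. D. Murray, R. R. Williams, *Circuit lower bounds for nondeterministic quasi-polytime: an easy
  witness lemma for NP and NQP*, STOC 2018, §5 (the circuit `D` over `EVAL-GATE`)
  [MurrayWilliams2018].
* H. Vollmer, *Introduction to Circuit Complexity*, Springer 1999, §1.2 (substitution of
  constants and circuits for inputs) [Vollmer1999].
-/

namespace Literature.Computability.Complexity

open Finset GateList

variable {ι ι' : Type*}

namespace GateList

/-! ### The `∧`/`∨` of a list of blocks -/

/-- The argument wires of the final gate: the output wires of the juxtaposed blocks. [folklore] -/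
def bigArgs (bs : List (List (Gate ι) × (ι ⊕ ℕ))) : Fin bs.length → ι ⊕ ℕ :=
  fun a => (parBlocks bs).2[a.1]'(by rw [length_parBlocks_snd]; exact a.2)

/-- **The `∧` (`isAnd = true`) or `∨` of a list of blocks**: the blocks side by side, then one
unbounded fan-in gate reading their output wires; output = that gate (Vollmer 1999, §1.2).
[cite: Vollmer1999, §1.2] -/
def bigBlock (isAnd : Bool) (bs : List (List (Gate ι) × (ι ⊕ ℕ))) : List (Gate ι) × (ι ⊕ ℕ) :=
  ((parBlocks bs).1 ++ [bigGate isAnd bs.length (bigArgs bs)], Sum.inr (parBlocks bs).1.length)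

variable (isAnd : Bool) (bs : List (List (Gate ι) × (ι ⊕ ℕ)))

/-- Length of the `∧`/`∨` block: the blocks and one gate. [folklore] -/
theorem length_bigBlock : (bigBlock isAnd bs).1.length = (bs.map fun b => b.1.length).sum + 1 := by
  simp [bigBlock, length_parBlocks_fst]

/-- The `∧`/`∨` block is well formed if the blocks are (with valid output wires). [folklore] -/
theorem wf_bigBlock (hwf : ∀ b ∈ bs, WF b.1) (ho : ∀ b ∈ bs, OutOK b.1.length b.2) :
    WF (bigBlock isAnd bs).1 :=
  (wf_parBlocks bs hwf).append_singleton fun _ m hm =>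
    outOK_parBlocks bs ho _ (List.getElem_mem _) m hm

/-- The output wire of the `∧`/`∨` block is valid. [folklore] -/
theorem outOK_bigBlock : OutOK (bigBlock isAnd bs).1.length (bigBlock isAnd bs).2 := by
  intro m hm
  simp only [bigBlock, Sum.inr.injEq] at hm
  subst hm
  simp [bigBlock]

/-- The gates of the `∧`/`∨` block: those of the blocks and one `∧`/`∨` gate. [folklore] -/
theorem fn_mem_bigBlock {B : Set GateFn} (hB : acBasis ⊆ B) (h : ∀ b ∈ bs, ∀ g ∈ b.1, g.fn ∈ B) :
    ∀ g ∈ (bigBlock isAnd bs).1, g.fn ∈ B := by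
  intro g hg
  simp only [bigBlock, List.mem_append, List.mem_singleton] at hg
  rcases hg with hg | rfl
  · exact fn_mem_parBlocks bs h g hg
  · rw [bigGate_fn]
    cases isAnd
    · exact hB (or_mem_acBasis _)
    · exact hB (and_mem_acBasis _)

/-- The arities in the `∧`/`∨` block: those of the blocks and the number of blocks. [folklore] -/
theorem arity_le_of_mem_bigBlock {K : ℕ} (h : ∀ b ∈ bs, ∀ g ∈ b.1, g.arity ≤ K)
    (hK : bs.length ≤ K) : ∀ g ∈ (bigBlock isAnd bs).1, g.arity ≤ K := by
  intro g hg
  simp only [bigBlock, List.mem_append, List.mem_singleton] at hg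
  rcases hg with hg | rfl
  · have hmem := fn_mem_parBlocks (B := {f : GateFn | f.1 ≤ K}) bs
      (fun b hb g' hg' => h b hb g' hg') g hg
    exact hmem
  · exact hK

/-- The `a`-th argument wire of the final gate carries the value of the `a`-th block. [folklore] -/
theorem wireOf_bigArgs (ho : ∀ b ∈ bs, OutOK b.1.length b.2) (x : ι → Bool) (a : Fin bs.length) :
    wireOf x (vals (parBlocks bs).1 x) (bigArgs bs a) =
      wireOf x (vals (bs[a.1]).1 x) (bs[a.1]).2 :=
  wireOf_parBlocks x bs ho a.1 (by rw [length_parBlocks_snd]; exact a.2) a.2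

/-- **Value of the `∧`/`∨` block**: the conjunction (disjunction) of the values of the blocks.
[cite: Vollmer1999, §1.2] -/
theorem wireOf_bigBlock (ho : ∀ b ∈ bs, OutOK b.1.length b.2) (x : ι → Bool) :
    wireOf x (vals (bigBlock isAnd bs).1 x) (bigBlock isAnd bs).2 =
      if isAnd then decide (∀ a : Fin bs.length, wireOf x (vals (bs[a.1]).1 x) (bs[a.1]).2 = true)
      else decide (∃ a : Fin bs.length, wireOf x (vals (bs[a.1]).1 x) (bs[a.1]).2 = true) := by
  simp only [bigBlock, wireOf_inr]
  rw [vals_append_singleton, List.getD_eq_getElem?_getD,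
    List.getElem?_append_right (by simp), length_vals, Nat.sub_self]
  simp only [List.getElem?_cons_zero, Option.getD_some, bigGate]
  cases isAnd
  · simp only [Bool.false_eq_true, if_false, GateFn.or]
    simp [wireOf_bigArgs bs ho x]
  · simp only [if_true, GateFn.and]
    simp [wireOf_bigArgs bs ho x]

/-- **Depth of the `∧`/`∨` block**: one more than the deepest block. [cite: Vollmer1999, §1.2] -/
theorem wireDepthOf_bigBlock_le (ho : ∀ b ∈ bs, OutOK b.1.length b.2) {d : ℕ}
    (hd : ∀ b ∈ bs, wireDepthOf (wdepths acWeight b.1) b.2 ≤ d) :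
    wireDepthOf (wdepths acWeight (bigBlock isAnd bs).1) (bigBlock isAnd bs).2 ≤ d + 1 := by
  have hdepj : ∀ a : Fin bs.length,
      wireDepthOf (wdepths acWeight (parBlocks bs).1) (bigArgs bs a) ≤ d := by
    intro a
    have h := wireDepthOf_parBlocks acWeight bs ho a.1
      (by rw [length_parBlocks_snd]; exact a.2) a.2
    rw [show wireDepthOf (wdepths acWeight (parBlocks bs).1) (bigArgs bs a) = _ from h]
    exact hd _ (List.getElem_mem _)
  simp only [bigBlock, wireDepthOf_inr]
  rw [getD_wdepths_append_singleton, bigGate_fn]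
  have hw1 : acWeight (if isAnd = true then GateFn.and bs.length else GateFn.or bs.length) = 1 := by
    cases isAnd <;> simp
  rw [hw1, add_comm]
  exact Nat.add_le_add_right (Finset.sup_le fun a _ => hdepj a) 1

/-! ### A possibly negated hard-wired copy -/

/-- **A literal over a hard-wired copy of `E`**: the hard-wiring block of `E` along `σ`
(`hwGates`, inputs of `E` sent to inputs of the new circuit or to constants), followed by a
`¬` gate on its output when `pol = false`. [cite: Vollmer1999, §1.2] -/
def litBlock (E : Circuit ι') (σ : ι' → ι ⊕ Bool) (pol : Bool) : List (Gate ι) × (ι ⊕ ℕ) :=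
  match pol with
  | true => (hwGates E σ, hwOut E σ)
  | false => (hwGates E σ ++ [notGate (hwOut E σ)], Sum.inr (hwGates E σ : List (Gate ι)).length)

variable (E : Circuit ι') (σ : ι' → ι ⊕ Bool)

/-- The literal block has `E.size + 2` gates (positive) or `E.size + 3` (negative). [folklore] -/
theorem length_litBlock (pol : Bool) :
    (litBlock E σ pol).1.length = E.size + 2 + (if pol then 0 else 1) := by
  cases pol <;> simp [litBlock]

/-- The literal block has at most `E.size + 3` gates. [folklore] -/
theorem length_litBlock_le (pol : Bool) : (litBlock E σ pol).1.length ≤ E.size + 3 := by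
  rw [length_litBlock]; split <;> omega

/-- The literal block is well formed. [folklore] -/
theorem wf_litBlock (pol : Bool) : WF (litBlock E σ pol).1 := by
  cases pol
  · exact (wf_hwGates E σ).append_singleton fun _ m hm => outOK_hwOut E σ m hm
  · exact wf_hwGates E σ

/-- The output wire of the literal block is valid. [folklore] -/
theorem outOK_litBlock (pol : Bool) : OutOK (litBlock E σ pol).1.length (litBlock E σ pol).2 := by
  cases pol
  · intro m hm
    simp only [litBlock, Sum.inr.injEq] at hm
    subst hm
    simp [litBlock]
  · exact outOK_hwOut E σ

/-- The gates of the literal block: the constants, the gates of `E`, possibly a `¬` gate —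
over any basis containing `acBasis` and the gates of `E`. [folklore] -/
theorem fn_mem_litBlock {B : Set GateFn} (hB : acBasis ⊆ B) (hE : E.IsOver B) (pol : Bool) :
    ∀ g ∈ (litBlock E σ pol).1, g.fn ∈ B := by
  have hcopy := fn_mem_hwGates (hB (or_mem_acBasis 0)) (hB (and_mem_acBasis 0)) hE σ
  cases pol
  · intro g hg
    simp only [litBlock, List.mem_append, List.mem_singleton] at hg
    rcases hg with hg | rfl
    · exact hcopy g hg
    · rw [notGate_fn]; exact hB mem_acBasis_not
  · exact hcopy

/-- The arities in the literal block are at most `max E.maxFanIn 1`. [folklore] -/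
theorem arity_le_of_mem_litBlock (pol : Bool) :
    ∀ g ∈ (litBlock E σ pol).1, g.arity ≤ max E.maxFanIn 1 := by
  cases pol
  · intro g hg
    simp only [litBlock, List.mem_append, List.mem_singleton] at hg
    rcases hg with hg | rfl
    · exact (arity_le_of_mem_hwGates E σ g hg).trans (le_max_left _ _)
    · exact le_max_right _ _
  · exact fun g hg => (arity_le_of_mem_hwGates E σ g hg).trans (le_max_left _ _)

/-- **Value of the literal block**: `[E(x ∘ σ) = pol]`, where `x ∘ σ` reads the new inputs or the
hard-wired constants (`wireOf_hwOut`). [cite: Vollmer1999, §1.2] -/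
theorem wireOf_litBlock (pol : Bool) (x : ι → Bool) :
    wireOf x (vals (litBlock E σ pol).1 x) (litBlock E σ pol).2 =
      decide (E.eval (fun j => Sum.elim x id (σ j)) = pol) := by
  cases pol
  · simp only [litBlock, wireOf_inr]
    rw [vals_append_singleton, List.getD_eq_getElem?_getD,
      List.getElem?_append_right (by simp), length_vals, Nat.sub_self]
    simp [notGate, wireOf_hwOut]
  · simp only [litBlock]
    rw [wireOf_hwOut]
    simp

/-- **Depth of the literal block**: at most `E.acDepth + 1` (the constants have depth `1`;
the negation is free). [cite: Vollmer1999, §1.2] -/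
theorem wireDepthOf_litBlock_le (pol : Bool) :
    wireDepthOf (wdepths acWeight (litBlock E σ pol).1) (litBlock E σ pol).2 ≤ E.acDepth + 1 := by
  cases pol
  · simp only [litBlock, wireDepthOf_inr]
    rw [getD_wdepths_append_singleton, notGate_fn, acWeight_not, zero_add]
    refine Finset.sup_le fun a _ => ?_
    simpa [notGate] using wireDepthOf_hwOut_le E σ
  · exact wireDepthOf_hwOut_le E σ

end GateList

/-! ### The DNF over the copies -/

namespace Circuit

variable (E : Circuit ι') (pats : List (List ((ι' → ι ⊕ Bool) × Bool)))

/-- The conjunction block of one pattern: the `∧` of its literal blocks. [cite: MurrayWilliams2018, §5 (proof of Thm. 1.1)] -/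
def termBlock (E : Circuit ι') (p : List ((ι' → ι ⊕ Bool) × Bool)) : List (Gate ι) × (ι ⊕ ℕ) :=
  bigBlock true (p.map fun q => litBlock E q.1 q.2)

/-- The disjunction block of all patterns. [cite: MurrayWilliams2018, §5 (proof of Thm. 1.1)] -/
def dnfBlock (E : Circuit ι') (pats : List (List ((ι' → ι ⊕ Bool) × Bool))) :
    List (Gate ι) × (ι ⊕ ℕ) :=
  bigBlock false (pats.map (termBlock E))

/-- Every conjunction block is well formed with a valid output wire. [folklore] -/
theorem wf_termBlock (p : List ((ι' → ι ⊕ Bool) × Bool)) :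
    WF (termBlock E p : List (Gate ι) × (ι ⊕ ℕ)).1 ∧
      OutOK (termBlock E p : List (Gate ι) × (ι ⊕ ℕ)).1.length (termBlock E p).2 := by
  refine ⟨wf_bigBlock true _ (fun b hb => ?_) (fun b hb => ?_), outOK_bigBlock true _⟩
  · simp only [List.mem_map] at hb
    obtain ⟨q, -, rfl⟩ := hb
    exact wf_litBlock E q.1 q.2
  · simp only [List.mem_map] at hb
    obtain ⟨q, -, rfl⟩ := hb
    exact outOK_litBlock E q.1 q.2

/-- The disjunction block is well formed. [folklore] -/
theorem wf_dnfBlock : WF (dnfBlock E pats : List (Gate ι) × (ι ⊕ ℕ)).1 :=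
  wf_bigBlock false _
    (fun b hb => by
      simp only [List.mem_map] at hb
      obtain ⟨p, -, rfl⟩ := hb
      exact (wf_termBlock E p).1)
    (fun b hb => by
      simp only [List.mem_map] at hb
      obtain ⟨p, -, rfl⟩ := hb
      exact (wf_termBlock E p).2)

/-- **The DNF over hard-wired copies of `E`**: `⋁_{p ∈ pats} ⋀_{(σ, pol) ∈ p} [E(x ∘ σ) = pol]`
as a circuit on the inputs `ι` (Murray–Williams 2018, §5: the consistency circuit `D` built
from the guessed circuit `E`, "`C` is closed under conjunctions and projections"; Williams 2014,
proof of Thm. 3.2). [cite: MurrayWilliams2018, §5 (proof of Thm. 1.1)] -/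
def dnfOfCopies : Circuit ι :=
  toCircuit (dnfBlock E pats).1 (dnfBlock E pats).2 (wf_dnfBlock E pats)
    (outOK_bigBlock false _)

/-- **Semantics**: `(dnfOfCopies E pats)(x) = [∃ p ∈ pats, ∀ (σ, pol) ∈ p, E(x ∘ σ) = pol]`
(patterns and literals by position). [cite: MurrayWilliams2018, §5 (proof of Thm. 1.1)] -/
theorem eval_dnfOfCopies (x : ι → Bool) :
    (dnfOfCopies E pats).eval x =
      decide (∃ a : Fin pats.length, ∀ b : Fin (pats[a.1]).length,
        E.eval (fun j => Sum.elim x id (((pats[a.1])[b.1]).1 j)) = ((pats[a.1])[b.1]).2) := by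
  rw [circuit_eval]
  change wireOf x (vals (dnfBlock E pats).1 x) (dnfBlock E pats).2 = _
  unfold dnfBlock
  rw [wireOf_bigBlock false _ (fun b hb => by
    simp only [List.mem_map] at hb
    obtain ⟨p, -, rfl⟩ := hb
    exact (wf_termBlock E p).2)]
  simp only [Bool.false_eq_true, if_false]
  have hterm : ∀ (p : List ((ι' → ι ⊕ Bool) × Bool)),
      wireOf x (vals (termBlock E p : List (Gate ι) × (ι ⊕ ℕ)).1 x) (termBlock E p).2 =
        decide (∀ b : Fin p.length, E.eval (fun j => Sum.elim x id ((p[b.1]).1 j)) = (p[b.1]).2) := by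
    intro p
    unfold termBlock
    rw [wireOf_bigBlock true _ (fun b hb => by
      simp only [List.mem_map] at hb
      obtain ⟨q, -, rfl⟩ := hb
      exact outOK_litBlock E q.1 q.2)]
    simp only [if_true]
    apply Bool.decide_congr
    constructor
    · intro h b
      have hb : (b.1 : ℕ) < (p.map fun q => litBlock E q.1 q.2).length := by simp
      have := h ⟨b.1, hb⟩
      rw [List.getElem_map, wireOf_litBlock] at this
      simpa using this
    · intro h a
      have ha : (a.1 : ℕ) < p.length := by simpa using a.2
      rw [List.getElem_map, wireOf_litBlock]
      simpa using h ⟨a.1, ha⟩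
  apply Bool.decide_congr
  constructor
  · rintro ⟨a, ha⟩
    have ha' : (a.1 : ℕ) < pats.length := by simpa using a.2
    refine ⟨⟨a.1, ha'⟩, ?_⟩
    rw [List.getElem_map, hterm] at ha
    simpa using ha
  · rintro ⟨a, ha⟩
    have ha' : (a.1 : ℕ) < (pats.map (termBlock E)).length := by simp
    refine ⟨⟨a.1, ha'⟩, ?_⟩
    rw [List.getElem_map, hterm]
    simpa using ha

/-- **Semantics, membership form**: `(dnfOfCopies E pats)(x) = 1` iff some pattern of `pats` has
all its literals satisfied at `x`. [cite: MurrayWilliams2018, §5 (proof of Thm. 1.1)] -/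
theorem eval_dnfOfCopies_eq_true_iff (x : ι → Bool) :
    (dnfOfCopies E pats).eval x = true ↔
      ∃ p ∈ pats, ∀ q ∈ p, E.eval (fun j => Sum.elim x id (q.1 j)) = q.2 := by
  rw [eval_dnfOfCopies, decide_eq_true_eq]
  constructor
  · rintro ⟨a, ha⟩
    refine ⟨pats[a.1], List.getElem_mem _, fun q hq => ?_⟩
    obtain ⟨b, hb, rfl⟩ := List.mem_iff_getElem.1 hq
    exact ha ⟨b, hb⟩
  · rintro ⟨p, hp, h⟩
    obtain ⟨a, ha, rfl⟩ := List.mem_iff_getElem.1 hp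
    exact ⟨⟨a, ha⟩, fun b => h _ (List.getElem_mem _)⟩

/-- **Unsatisfiability, membership form**: `dnfOfCopies E pats` is unsatisfiable iff at every
input every pattern has a violated literal — the use in the simulations ("`D` is unsatisfiable"
certifies the consistency of the guessed circuit `E` at every index).
[cite: MurrayWilliams2018, §5 (proof of Thm. 1.1)] -/
theorem not_satisfiable_dnfOfCopies_iff :
    ¬ (dnfOfCopies E pats).Satisfiable ↔
      ∀ (x : ι → Bool), ∀ p ∈ pats, ∃ q ∈ p, E.eval (fun j => Sum.elim x id (q.1 j)) ≠ q.2 := by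
  unfold Circuit.Satisfiable
  simp only [not_exists]
  refine forall_congr' fun x => ?_
  rw [eval_dnfOfCopies_eq_true_iff]
  push Not
  rfl

/-- **Basis**: over any basis containing the unbounded fan-in `∧`/`∨`/`¬` gates (and the
constants `∧₀`, `∨₀`) and the gates of `E`. [cite: MurrayWilliams2018, §5 (proof of Thm. 1.1)] -/
theorem dnfOfCopies_isOver {B : Set GateFn} (hB : acBasis ⊆ B) (hE : E.IsOver B) :
    (dnfOfCopies E pats).IsOver B := by
  intro g hg
  change g ∈ (dnfBlock E pats).1 at hg
  refine fn_mem_bigBlock false _ hB (fun b hb g' hg' => ?_) g hg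
  simp only [List.mem_map] at hb
  obtain ⟨p, -, rfl⟩ := hb
  refine fn_mem_bigBlock true _ hB (fun b' hb' g'' hg'' => ?_) g' hg'
  simp only [List.mem_map] at hb'
  obtain ⟨q, -, rfl⟩ := hb'
  exact fn_mem_litBlock E q.1 hB hE q.2 g'' hg''

/-- The DNF of an `AC⁰[m]` circuit is an `AC⁰[m]` circuit. [cite: MurrayWilliams2018, §5 (proof of Thm. 1.1)] -/
theorem dnfOfCopies_isOver_accBasis {m : ℕ} (hE : E.IsOver (accBasis m)) :
    (dnfOfCopies E pats).IsOver (accBasis m) :=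
  dnfOfCopies_isOver E pats (acBasis_subset_accBasis m) hE

/-- **Size**: at most `|pats| · (w · (E.size + 3) + 1) + 1` gates if every pattern has at most
`w` literals. [cite: MurrayWilliams2018, §5 (proof of Thm. 1.1)] -/
theorem size_dnfOfCopies_le {w : ℕ} (hw : ∀ p ∈ pats, p.length ≤ w) :
    (dnfOfCopies E pats).size ≤ pats.length * (w * (E.size + 3) + 1) + 1 := by
  change (dnfBlock E pats).1.length ≤ _
  unfold dnfBlock
  rw [length_bigBlock]
  refine Nat.add_le_add_right ?_ 1
  have hterm : ∀ p ∈ pats,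
      (termBlock E p : List (Gate ι) × (ι ⊕ ℕ)).1.length ≤ w * (E.size + 3) + 1 := by
    intro p hp
    unfold termBlock
    rw [length_bigBlock]
    refine Nat.add_le_add_right ?_ 1
    calc ((p.map fun q => litBlock E q.1 q.2).map fun b => b.1.length).sum
        ≤ ((p.map fun q => litBlock E q.1 q.2).map fun _ => E.size + 3).sum :=
          List.sum_le_sum (fun b hb => by
            simp only [List.mem_map] at hb
            obtain ⟨q, -, rfl⟩ := hb
            exact length_litBlock_le E q.1 q.2)
      _ = p.length * (E.size + 3) := by
          simp only [List.map_map, Function.comp_def, List.map_const', List.sum_replicate,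
            smul_eq_mul]
      _ ≤ w * (E.size + 3) := Nat.mul_le_mul_right _ (hw p hp)
  calc ((pats.map (termBlock E)).map fun b => b.1.length).sum
      ≤ ((pats.map (termBlock E)).map fun _ => w * (E.size + 3) + 1).sum :=
        List.sum_le_sum (fun b hb => by
          simp only [List.mem_map] at hb
          obtain ⟨p, hp, rfl⟩ := hb
          exact hterm p hp)
    _ = pats.length * (w * (E.size + 3) + 1) := by
        simp only [List.map_map, Function.comp_def, List.map_const', List.sum_replicate,
          smul_eq_mul]

/-- **Depth**: `acDepth ≤ E.acDepth + 3` (constants, the `∧` layer, the `∨` layer; negations are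
free). [cite: MurrayWilliams2018, §5 (proof of Thm. 1.1)] -/
theorem acDepth_dnfOfCopies_le : (dnfOfCopies E pats).acDepth ≤ E.acDepth + 3 := by
  change Circuit.depthWith _ acWeight ≤ _
  rw [circuit_depthWith]
  change wireDepthOf (wdepths acWeight (dnfBlock E pats).1) (dnfBlock E pats).2 ≤ _
  unfold dnfBlock
  refine wireDepthOf_bigBlock_le false _ (fun b hb => ?_) (d := E.acDepth + 2) (fun b hb => ?_)
  · simp only [List.mem_map] at hb
    obtain ⟨p, -, rfl⟩ := hb
    exact (wf_termBlock E p).2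
  · simp only [List.mem_map] at hb
    obtain ⟨p, -, rfl⟩ := hb
    unfold termBlock
    refine wireDepthOf_bigBlock_le true _ (fun b' hb' => ?_) (d := E.acDepth + 1) (fun b' hb' => ?_)
    · simp only [List.mem_map] at hb'
      obtain ⟨q, -, rfl⟩ := hb'
      exact outOK_litBlock E q.1 q.2
    · simp only [List.mem_map] at hb'
      obtain ⟨q, -, rfl⟩ := hb'
      exact wireDepthOf_litBlock_le E q.1 q.2

/-- **Fan-in**: the copies keep the arities of `E`; the new gates have fan-in the pattern
lengths, the number of patterns, or `1`. [cite: MurrayWilliams2018, §5 (proof of Thm. 1.1)] -/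
theorem maxFanIn_dnfOfCopies_le {w : ℕ} (hw : ∀ p ∈ pats, p.length ≤ w) :
    (dnfOfCopies E pats).maxFanIn ≤ max (max E.maxFanIn 1) (max w pats.length) := by
  rw [Circuit.maxFanIn_le_iff]
  intro g hg
  change g ∈ (dnfBlock E pats).1 at hg
  unfold dnfBlock at hg
  refine arity_le_of_mem_bigBlock false _ (fun b hb g' hg' => ?_)
    (by rw [List.length_map]; exact (le_max_right _ _).trans (le_max_right _ _)) g hg
  simp only [List.mem_map] at hb
  obtain ⟨p, hp, rfl⟩ := hb
  unfold termBlock at hg'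
  refine arity_le_of_mem_bigBlock true _ (fun b' hb' g'' hg'' => ?_)
    (by rw [List.length_map]; exact ((hw p hp).trans (le_max_left _ _)).trans (le_max_right _ _))
    g' hg'
  simp only [List.mem_map] at hb'
  obtain ⟨q, -, rfl⟩ := hb'
  exact (arity_le_of_mem_litBlock E q.1 q.2 g'' hg'').trans (le_max_left _ _)

/-! ### The DNF with a circuit per literal -/

variable (lpats : List (List (Circuit ι' × (ι' → ι ⊕ Bool) × Bool)))

/-- The conjunction block of one pattern of circuit literals. [cite: Williams2014, Thm. 3.2 (proof)] -/
def litTermBlock (p : List (Circuit ι' × (ι' → ι ⊕ Bool) × Bool)) : List (Gate ι) × (ι ⊕ ℕ) :=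
  bigBlock true (p.map fun q => litBlock q.1 q.2.1 q.2.2)

/-- The disjunction block of all patterns of circuit literals. [cite: Williams2014, Thm. 3.2 (proof)] -/
def litDnfBlock (lpats : List (List (Circuit ι' × (ι' → ι ⊕ Bool) × Bool))) :
    List (Gate ι) × (ι ⊕ ℕ) :=
  bigBlock false (lpats.map litTermBlock)

/-- Every conjunction block of circuit literals is well formed with a valid output wire.
[folklore] -/
theorem wf_litTermBlock (p : List (Circuit ι' × (ι' → ι ⊕ Bool) × Bool)) :
    WF (litTermBlock p : List (Gate ι) × (ι ⊕ ℕ)).1 ∧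
      OutOK (litTermBlock p : List (Gate ι) × (ι ⊕ ℕ)).1.length (litTermBlock p).2 := by
  refine ⟨wf_bigBlock true _ (fun b hb => ?_) (fun b hb => ?_), outOK_bigBlock true _⟩
  · simp only [List.mem_map] at hb
    obtain ⟨q, -, rfl⟩ := hb
    exact wf_litBlock q.1 q.2.1 q.2.2
  · simp only [List.mem_map] at hb
    obtain ⟨q, -, rfl⟩ := hb
    exact outOK_litBlock q.1 q.2.1 q.2.2

/-- The disjunction block of circuit literals is well formed. [folklore] -/
theorem wf_litDnfBlock : WF (litDnfBlock lpats : List (Gate ι) × (ι ⊕ ℕ)).1 :=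
  wf_bigBlock false _
    (fun b hb => by
      simp only [List.mem_map] at hb
      obtain ⟨p, -, rfl⟩ := hb
      exact (wf_litTermBlock p).1)
    (fun b hb => by
      simp only [List.mem_map] at hb
      obtain ⟨p, -, rfl⟩ := hb
      exact (wf_litTermBlock p).2)

/-- **The DNF over literals of hard-wired circuit copies**, one circuit per literal:
`⋁_{p ∈ lpats} ⋀_{(C, σ, pol) ∈ p} [C(x ∘ σ) = pol]` (Williams 2014, proof of Thm. 3.2: the
instance `D` mixes copies of the clause circuits and of the witness circuit `W`;
Murray–Williams 2018, §5). [cite: Williams2014, Thm. 3.2 (proof)] -/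
def dnfOfLits : Circuit ι :=
  toCircuit (litDnfBlock lpats).1 (litDnfBlock lpats).2 (wf_litDnfBlock lpats)
    (outOK_bigBlock false _)

/-- **Semantics** (patterns and literals by position). [cite: Williams2014, Thm. 3.2 (proof)] -/
theorem eval_dnfOfLits (x : ι → Bool) :
    (dnfOfLits lpats).eval x =
      decide (∃ a : Fin lpats.length, ∀ b : Fin (lpats[a.1]).length,
        ((lpats[a.1])[b.1]).1.eval (fun j => Sum.elim x id (((lpats[a.1])[b.1]).2.1 j)) =
          ((lpats[a.1])[b.1]).2.2) := by
  rw [circuit_eval]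
  change wireOf x (vals (litDnfBlock lpats).1 x) (litDnfBlock lpats).2 = _
  unfold litDnfBlock
  rw [wireOf_bigBlock false _ (fun b hb => by
    simp only [List.mem_map] at hb
    obtain ⟨p, -, rfl⟩ := hb
    exact (wf_litTermBlock p).2)]
  simp only [Bool.false_eq_true, if_false]
  have hterm : ∀ (p : List (Circuit ι' × (ι' → ι ⊕ Bool) × Bool)),
      wireOf x (vals (litTermBlock p : List (Gate ι) × (ι ⊕ ℕ)).1 x) (litTermBlock p).2 =
        decide (∀ b : Fin p.length,
          (p[b.1]).1.eval (fun j => Sum.elim x id ((p[b.1]).2.1 j)) = (p[b.1]).2.2) := by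
    intro p
    unfold litTermBlock
    rw [wireOf_bigBlock true _ (fun b hb => by
      simp only [List.mem_map] at hb
      obtain ⟨q, -, rfl⟩ := hb
      exact outOK_litBlock q.1 q.2.1 q.2.2)]
    simp only [if_true]
    apply Bool.decide_congr
    constructor
    · intro h b
      have hb : (b.1 : ℕ) < (p.map fun q => litBlock q.1 q.2.1 q.2.2).length := by simp
      have := h ⟨b.1, hb⟩
      rw [List.getElem_map, wireOf_litBlock] at this
      simpa using this
    · intro h a
      have ha : (a.1 : ℕ) < p.length := by simpa using a.2
      rw [List.getElem_map, wireOf_litBlock]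
      simpa using h ⟨a.1, ha⟩
  apply Bool.decide_congr
  constructor
  · rintro ⟨a, ha⟩
    have ha' : (a.1 : ℕ) < lpats.length := by simpa using a.2
    refine ⟨⟨a.1, ha'⟩, ?_⟩
    rw [List.getElem_map, hterm] at ha
    simpa using ha
  · rintro ⟨a, ha⟩
    have ha' : (a.1 : ℕ) < (lpats.map litTermBlock).length := by simp
    refine ⟨⟨a.1, ha'⟩, ?_⟩
    rw [List.getElem_map, hterm]
    simpa using ha

/-- **Semantics, membership form.** [cite: Williams2014, Thm. 3.2 (proof)] -/
theorem eval_dnfOfLits_eq_true_iff (x : ι → Bool) :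
    (dnfOfLits lpats).eval x = true ↔
      ∃ p ∈ lpats, ∀ q ∈ p, q.1.eval (fun j => Sum.elim x id (q.2.1 j)) = q.2.2 := by
  rw [eval_dnfOfLits, decide_eq_true_eq]
  constructor
  · rintro ⟨a, ha⟩
    refine ⟨lpats[a.1], List.getElem_mem _, fun q hq => ?_⟩
    obtain ⟨b, hb, rfl⟩ := List.mem_iff_getElem.1 hq
    exact ha ⟨b, hb⟩
  · rintro ⟨p, hp, h⟩
    obtain ⟨a, ha, rfl⟩ := List.mem_iff_getElem.1 hp
    exact ⟨⟨a, ha⟩, fun b => h _ (List.getElem_mem _)⟩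

/-- **Unsatisfiability, membership form**: at every input every pattern has a violated literal.
[cite: Williams2014, Thm. 3.2 (proof)] -/
theorem not_satisfiable_dnfOfLits_iff :
    ¬ (dnfOfLits lpats).Satisfiable ↔
      ∀ (x : ι → Bool), ∀ p ∈ lpats, ∃ q ∈ p,
        q.1.eval (fun j => Sum.elim x id (q.2.1 j)) ≠ q.2.2 := by
  unfold Circuit.Satisfiable
  simp only [not_exists]
  refine forall_congr' fun x => ?_
  rw [eval_dnfOfLits_eq_true_iff]
  push Not
  rfl

/-- **Basis**: over any `B ⊇ acBasis` over which all literal circuits are.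
[cite: Williams2014, Thm. 3.2 (proof)] -/
theorem dnfOfLits_isOver {B : Set GateFn} (hB : acBasis ⊆ B)
    (hC : ∀ p ∈ lpats, ∀ q ∈ p, q.1.IsOver B) : (dnfOfLits lpats).IsOver B := by
  intro g hg
  change g ∈ (litDnfBlock lpats).1 at hg
  refine fn_mem_bigBlock false _ hB (fun b hb g' hg' => ?_) g hg
  simp only [List.mem_map] at hb
  obtain ⟨p, hp, rfl⟩ := hb
  refine fn_mem_bigBlock true _ hB (fun b' hb' g'' hg'' => ?_) g' hg'
  simp only [List.mem_map] at hb'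
  obtain ⟨q, hq, rfl⟩ := hb'
  exact fn_mem_litBlock q.1 q.2.1 hB (hC p hp q hq) q.2.2 g'' hg''

/-- **Size**: at most `|lpats| · (w · (S + 3) + 1) + 1` gates if every pattern has at most `w`
literals and every literal circuit at most `S` gates. [cite: Williams2014, Thm. 3.2 (proof)] -/
theorem size_dnfOfLits_le {w S : ℕ} (hw : ∀ p ∈ lpats, p.length ≤ w)
    (hS : ∀ p ∈ lpats, ∀ q ∈ p, q.1.size ≤ S) :
    (dnfOfLits lpats).size ≤ lpats.length * (w * (S + 3) + 1) + 1 := by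
  change (litDnfBlock lpats).1.length ≤ _
  unfold litDnfBlock
  rw [length_bigBlock]
  refine Nat.add_le_add_right ?_ 1
  have hterm : ∀ p ∈ lpats,
      (litTermBlock p : List (Gate ι) × (ι ⊕ ℕ)).1.length ≤ w * (S + 3) + 1 := by
    intro p hp
    unfold litTermBlock
    rw [length_bigBlock]
    refine Nat.add_le_add_right ?_ 1
    calc ((p.map fun q => litBlock q.1 q.2.1 q.2.2).map fun b => b.1.length).sum
        ≤ ((p.map fun q => litBlock q.1 q.2.1 q.2.2).map fun _ => S + 3).sum :=
          List.sum_le_sum (fun b hb => by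
            simp only [List.mem_map] at hb
            obtain ⟨q, hq, rfl⟩ := hb
            exact (length_litBlock_le q.1 q.2.1 q.2.2).trans (by have := hS p hp q hq; omega))
      _ = p.length * (S + 3) := by
          simp only [List.map_map, Function.comp_def, List.map_const', List.sum_replicate,
            smul_eq_mul]
      _ ≤ w * (S + 3) := Nat.mul_le_mul_right _ (hw p hp)
  calc ((lpats.map litTermBlock).map fun b => b.1.length).sum
      ≤ ((lpats.map litTermBlock).map fun _ => w * (S + 3) + 1).sum :=
        List.sum_le_sum (fun b hb => by
          simp only [List.mem_map] at hb
          obtain ⟨p, hp, rfl⟩ := hb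
          exact hterm p hp)
    _ = lpats.length * (w * (S + 3) + 1) := by
        simp only [List.map_map, Function.comp_def, List.map_const', List.sum_replicate,
          smul_eq_mul]

/-- **Depth**: `acDepth ≤ d + 3` if every literal circuit has `acDepth ≤ d`.
[cite: Williams2014, Thm. 3.2 (proof)] -/
theorem acDepth_dnfOfLits_le {d : ℕ} (hd : ∀ p ∈ lpats, ∀ q ∈ p, q.1.acDepth ≤ d) :
    (dnfOfLits lpats).acDepth ≤ d + 3 := by
  change Circuit.depthWith _ acWeight ≤ _
  rw [circuit_depthWith]
  change wireDepthOf (wdepths acWeight (litDnfBlock lpats).1) (litDnfBlock lpats).2 ≤ _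
  unfold litDnfBlock
  refine wireDepthOf_bigBlock_le false _ (fun b hb => ?_) (d := d + 2) (fun b hb => ?_)
  · simp only [List.mem_map] at hb
    obtain ⟨p, -, rfl⟩ := hb
    exact (wf_litTermBlock p).2
  · simp only [List.mem_map] at hb
    obtain ⟨p, hp, rfl⟩ := hb
    unfold litTermBlock
    refine wireDepthOf_bigBlock_le true _ (fun b' hb' => ?_) (d := d + 1) (fun b' hb' => ?_)
    · simp only [List.mem_map] at hb'
      obtain ⟨q, -, rfl⟩ := hb'
      exact outOK_litBlock q.1 q.2.1 q.2.2
    · simp only [List.mem_map] at hb'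
      obtain ⟨q, hq, rfl⟩ := hb'
      exact (wireDepthOf_litBlock_le q.1 q.2.1 q.2.2).trans
        (Nat.add_le_add_right (hd p hp q hq) 1)

/-- **Fan-in**: `≤ max (max F 1) (max w |lpats|)` if every literal circuit has fan-in `≤ F` and
every pattern at most `w` literals. [cite: Williams2014, Thm. 3.2 (proof)] -/
theorem maxFanIn_dnfOfLits_le {w F : ℕ} (hw : ∀ p ∈ lpats, p.length ≤ w)
    (hF : ∀ p ∈ lpats, ∀ q ∈ p, q.1.maxFanIn ≤ F) :
    (dnfOfLits lpats).maxFanIn ≤ max (max F 1) (max w lpats.length) := by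
  rw [Circuit.maxFanIn_le_iff]
  intro g hg
  change g ∈ (litDnfBlock lpats).1 at hg
  unfold litDnfBlock at hg
  refine arity_le_of_mem_bigBlock false _ (fun b hb g' hg' => ?_)
    (by rw [List.length_map]; exact (le_max_right _ _).trans (le_max_right _ _)) g hg
  simp only [List.mem_map] at hb
  obtain ⟨p, hp, rfl⟩ := hb
  unfold litTermBlock at hg'
  refine arity_le_of_mem_bigBlock true _ (fun b' hb' g'' hg'' => ?_)
    (by rw [List.length_map]; exact ((hw p hp).trans (le_max_left _ _)).trans (le_max_right _ _))
    g' hg'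
  simp only [List.mem_map] at hb'
  obtain ⟨q, hq, rfl⟩ := hb'
  refine (arity_le_of_mem_litBlock q.1 q.2.1 q.2.2 g'' hg'').trans ?_
  exact (max_le_max (hF p hp q hq) le_rfl).trans (le_max_left _ _)

end Circuit

end Literature.Computability.Complexity
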